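import Literature.NumberTheory.Automorphic.TateLocalFactors
import Literature.RepresentationTheory.TwistedCoinvariantsQuotientCharacter
import HarnessLib

/-!
# Twisted homotheties on `𝒮(F^ι)`: the origin is invisible in the `θ`-coinvariants (`θ ≠ c`)

Topic `NumberTheory/Automorphic`; namespace `Literature.NumberTheory.Automorphic` (the setting of `SchwartzPiHomothety`,
`SchwartzPiHomothetyCoinvariants`).  THEOREMS ONLY (no definition, no named fact).

Setting: a field `F` with a topology, an index type `ι`, a representation `π` of `Fˣ` on the Schwartz–Bruhat space
`𝒮(F^ι) = SchwartzBruhat (ι → F)` by TWISTED HOMOTHETIES, `(π t Ψ)(x) = c(t) Ψ(t x)` for a character `c : Fˣ →* ℂˣ`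
(the centre of `GL_n` in the mixed model of the type II dual pair `(GL_1, GL_n)`, [MoeglinVignerasWaldspurger1987, Chap. 3
§III.1]: `c = |·|^{n/2}` up to a unitary character), and a character `θ : Fˣ →* ℂˣ` by which one takes coinvariants.

* `apply_zero_eq` — `(π t Ψ)(0) = c(t) Ψ(0)`: the origin is a fixed point, so `Fˣ` acts on `𝒮(F^ι) ⧸ {Ψ | Ψ 0 = 0} ≅ ℂ`
  (evaluation at `0`) through the character `c`;
* `exists_sub_mem_ker_apply_zero_eq_zero` — **if `θ t₁ ≠ c t₁` for one `t₁`** (e.g. `θ` unitary and `c` not: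
  `|c ϖ| = q^{-n/2}`), every `Ψ` is congruent modulo `θ`-relations to a `Ψ₀` vanishing at (hence, being locally constant,
  NEAR) the origin — the `θ`-coinvariants of `𝒮(F^ι)` are spanned by `𝒮₀ = {Ψ | Ψ 0 = 0} = 𝒮(F^ι ∖ 0)`;
* `mem_span_of_mem_ker_apply_zero_eq_zero` — conversely a `Ψ₀ ∈ 𝒮₀` that is a `θ`-relation in `𝒮(F^ι)` is a `θ`-relation of
  functions in `𝒮₀`; together: `𝒮₀ ↪ 𝒮(F^ι)` induces an ISOMORPHISM on `θ`-coinvariants (the tree's generic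
  `TwistedCoinv.exists_linearEquiv_coinv_subrepresentation_of_ne` / `…exists_sub_mem_ker_of_ne` / `…mem_span_of_mem_ker_of_ne`,
  `Fˣ` being commutative), so on `θ`-coinvariants one may work with functions vanishing near `0`, whose orbital integrals
  `∫ θ(t)⁻¹ (π t Ψ)(x) dt` are FINITE shell sums.  Stated at the SUBMODULE level (`TwistedCoinv.ker`, no quotient types), the
  currency of `SchwartzPiHomothetyCoinvariants`.

This is the «`a) si χ ≠ id` … le point `0`» step of [MoeglinVignerasWaldspurger1987, Chap. 3 §III.7 a)] (held chunk p0073):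
the delta function at the origin contributes nothing to the `χ`-isotypic quotient; what remains, `𝒮(F^{n} ∖ 0)_χ ≅
ind_{P}^{GL_n}(1 ⊗ χ)`, is §III.2–III.3 there (tree: `SchwartzPiHomothetyCoinvariants`, seat B-p08).  Use: row IV-3a
`Liu2021.splitPlace_chiCoinv_iso_parabolicIndGL` (cell `hodgecm-mathlib`).  HC_CM is proved only modulo the 7 printed citations
until rung 0 of the ladder closes; this file is unconditional.

## References
* [MoeglinVignerasWaldspurger1987] C. Mœglin, M.-F. Vignéras, J.-L. Waldspurger, LNM 1291 (1987), Chap. 3 §III.1, §III.7 a).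
* [BernsteinZelevinsky1976] I. N. Bernstein, A. V. Zelevinsky, Russian Math. Surveys 31:3 (1976), §2.3.
-/

noncomputable section

open Literature.RepresentationTheory Literature.RepresentationTheory.TwistedCoinv

namespace Literature.NumberTheory.Automorphic

variable {F : Type*} [Field F] [TopologicalSpace F] {ι : Type*}
  (π : Representation ℂ Fˣ (SchwartzBruhat (ι → F))) (c : Fˣ →* ℂˣ)
  (hπ : ∀ (t : Fˣ) (Ψ : SchwartzBruhat (ι → F)) (x : ι → F),
    (π t Ψ : (ι → F) → ℂ) x = (c t : ℂ) * (Ψ : (ι → F) → ℂ) ((t : F) • x))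
  (θ : Fˣ →* ℂˣ)

include hπ in
/-- **The origin is fixed**: `(π t Ψ)(0) = c(t) Ψ(0)`. [cite: MoeglinVignerasWaldspurger1987, Chap. 3 §III.7 a)] -/
theorem apply_zero_eq (t : Fˣ) (Ψ : SchwartzBruhat (ι → F)) :
    (π t Ψ : (ι → F) → ℂ) 0 = (c t : ℂ) * (Ψ : (ι → F) → ℂ) 0 := by
  rw [hπ, smul_zero]

include hπ in
/-- `Fˣ` acts on `𝒮(F^ι) ⧸ 𝒮₀` through `c`: `π t Ψ − c t • Ψ` vanishes at the origin.
[cite: MoeglinVignerasWaldspurger1987, Chap. 3 §III.7 a)] -/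
theorem sub_smul_apply_zero (t : Fˣ) (Ψ : SchwartzBruhat (ι → F)) :
    ((π t Ψ - ((c t : ℂˣ) : ℂ) • Ψ : SchwartzBruhat (ι → F)) : (ι → F) → ℂ) 0 = 0 := by
  rw [Submodule.coe_sub, Submodule.coe_smul, Pi.sub_apply, Pi.smul_apply, smul_eq_mul, apply_zero_eq π c hπ, sub_self]

/-- The twisted homotheties commute with each other (`Fˣ` is commutative). [folklore] -/
private theorem commute_apply (t₁ t : Fˣ) : Commute (π t₁) (π t) := by
  change π t₁ * π t = π t * π t₁
  rw [← map_mul, mul_comm, map_mul]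

/-- Membership in the submodule `𝒮₀ = ker (ev₀)` of functions vanishing at the origin is `Ψ 0 = 0` (definitional).
[cite: MoeglinVignerasWaldspurger1987, Chap. 3 §III.7 a)] -/
theorem mem_ker_proj_zero_iff (Ψ : SchwartzBruhat (ι → F)) :
    Ψ ∈ LinearMap.ker ((LinearMap.proj (0 : ι → F)).comp (SchwartzBruhat (ι → F)).subtype) ↔
      (Ψ : (ι → F) → ℂ) 0 = 0 :=
  Iff.rfl

include hπ in
/-- **Surjectivity half: every `Ψ` is a function vanishing at the origin modulo `θ`-relations** (`θ t₁ ≠ c t₁` for one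
`t₁`): `Ψ − Ψ₀ ∈ TwistedCoinv.ker π θ` with `Ψ₀ = (θ t₁ − c t₁)⁻¹ • (π t₁ Ψ − c t₁ • Ψ)`, `Ψ₀ 0 = 0`.  So the
`θ`-coinvariants of `𝒮(F^ι)` are spanned by the classes of `𝒮(F^ι ∖ 0)`. [cite: MoeglinVignerasWaldspurger1987, Chap. 3 §III.7 a)] -/
theorem exists_sub_mem_ker_apply_zero_eq_zero {t₁ : Fˣ} (hne : θ t₁ ≠ c t₁) (Ψ : SchwartzBruhat (ι → F)) :
    ∃ Ψ₀ : SchwartzBruhat (ι → F), (Ψ₀ : (ι → F) → ℂ) 0 = 0 ∧ Ψ - Ψ₀ ∈ TwistedCoinv.ker π θ := by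
  have hne' : ((θ t₁ : ℂˣ) : ℂ) ≠ (c t₁ : ℂ) := fun h => hne (Units.ext h)
  obtain ⟨Ψ₀, h0, hΨ⟩ := TwistedCoinv.exists_sub_mem_ker_of_ne π θ
    (LinearMap.ker ((LinearMap.proj (0 : ι → F)).comp (SchwartzBruhat (ι → F)).subtype)) (c t₁ : ℂ)
    (fun Φ => (mem_ker_proj_zero_iff _).mpr (sub_smul_apply_zero π c hπ t₁ Φ)) hne' Ψ
  exact ⟨Ψ₀, (mem_ker_proj_zero_iff Ψ₀).mp h0, hΨ⟩

include hπ in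
/-- **Injectivity half: a function vanishing at the origin that is a `θ`-relation in `𝒮(F^ι)` is a `θ`-relation of
functions vanishing at the origin** (`θ t₁ ≠ c t₁` for one `t₁`): `𝒮₀ ∩ span {π t Φ − θ t • Φ | Φ ∈ 𝒮(F^ι)} ⊆
span {π t Φ₀ − θ t • Φ₀ | Φ₀ ∈ 𝒮₀}`.  With the surjectivity half: the inclusion `𝒮(F^ι ∖ 0) ↪ 𝒮(F^ι)` induces an
ISOMORPHISM on `θ`-coinvariants (the tree's `TwistedCoinv.exists_linearEquiv_coinv_subrepresentation_of_ne` states it on the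
quotients) — the delta function at the origin contributes nothing. [cite: MoeglinVignerasWaldspurger1987, Chap. 3 §III.7 a)]
[cite: BernsteinZelevinsky1976, §2.3] -/
theorem mem_span_of_mem_ker_apply_zero_eq_zero {t₁ : Fˣ} (hne : θ t₁ ≠ c t₁) {Ψ₀ : SchwartzBruhat (ι → F)}
    (h0 : (Ψ₀ : (ι → F) → ℂ) 0 = 0) (hker : Ψ₀ ∈ TwistedCoinv.ker π θ) :
    Ψ₀ ∈ Submodule.span ℂ (Set.range fun tΦ : Fˣ ×
        LinearMap.ker ((LinearMap.proj (0 : ι → F)).comp (SchwartzBruhat (ι → F)).subtype) =>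
      π tΦ.1 (tΦ.2 : SchwartzBruhat (ι → F)) - ((θ tΦ.1 : ℂˣ) : ℂ) • (tΦ.2 : SchwartzBruhat (ι → F))) := by
  have hne' : ((θ t₁ : ℂˣ) : ℂ) ≠ (c t₁ : ℂ) := fun h => hne (Units.ext h)
  exact TwistedCoinv.mem_span_of_mem_ker_of_ne π θ
    (LinearMap.ker ((LinearMap.proj (0 : ι → F)).comp (SchwartzBruhat (ι → F)).subtype)) (c t₁ : ℂ)
    (fun Φ => (mem_ker_proj_zero_iff _).mpr (sub_smul_apply_zero π c hπ t₁ Φ)) (commute_apply π t₁) hne'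
    ((mem_ker_proj_zero_iff Ψ₀).mpr h0) hker

end Literature.NumberTheory.Automorphic

end
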